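import Mathlib
import Summits.ResolutionOfSingularities.ResolutionOfSingularities.Theorems.HomologicalConductorPersistenceHypersurfaceJacobian
import HarnessLib

/-!
# The Bezoutian lemma: Jacobian determinants of complete intersections lie in the noether different

Crux `HomologicalConductor.Persistence` (stmt-ResolutionOfSingularities-16484), chain W4.4b, ASSIGN v0.8 stub-3 (i′)
"codimension-`c` complete-intersection Jacobian criterion, if cheap": the cheap, generic half.
`[OURS · L1 w44b]`; elementary (Cramer's rule in `R ⊗_S R`); NOT a statement of the manuscript under
review; AI-drafted (weaker than expert review).

Let `R = S[z₁, …, z_c]` be a commutative `S`-algebra generated by `z` (`Algebra.adjoin S (range z) = ⊤`).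
A **Bezoutian** (matrix of divided differences) for `R/S` is a matrix `Δ ∈ M_c(R ⊗_S R)` with
`Σⱼ Δᵢⱼ (zⱼ ⊗ 1 - 1 ⊗ zⱼ) = 0` for every `i` — e.g. for a presentation `R = S[Z]/(g₁, …, g_c)`, any
choice of divided differences `gᵢ(Z) - gᵢ(Z') = Σⱼ Δᵢⱼ(Z, Z') (Zⱼ - Z'ⱼ)` read in `R ⊗_S R`; then
`μ(Δᵢⱼ) = ∂gᵢ/∂zⱼ` and `μ(det Δ) = det(∂gᵢ/∂zⱼ)` is the Jacobian determinant of the presentation.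

* `lmul_det_mem_noetherDifferent` — **`μ(det Δ) ∈ 𝔑(R/S)`**: by Cramer (`adj Δ · Δ = det Δ · 1`)
  `det Δ · (zⱼ ⊗ 1 - 1 ⊗ zⱼ) = 0` for all `j`, and the centraliser condition propagates from the
  generators `zⱼ` to all of `R = S[z]`. (`c = 1`: the Euler element of
  `PersistenceMonogenicJacobian.aeval_derivative_mem_noetherDifferent`; the classical statement is
  "the noether different of a complete intersection contains the Jacobian determinant", Kunz,
  *Introduction to Plane Algebraic Curves*, App. G, Ex. 2 for `c = 1`.)
* `det_map_lmul_mem_noetherDifferent` — the same written as `det(μ(Δᵢⱼ)) ∈ 𝔑(R/S)`.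
* `det_map_lmul_mem_cohomologyAnnihilatorOfDegree` — hence **`det(μ(Δᵢⱼ)) ∈ caᵈ⁺¹(R)`** when `R` is
  module-finite projective over a noetherian `S` with `caᵈ⁺¹(S) = S`
  (`noetherDifferent_le_cohomologyAnnihilatorOfDegree`, p487241).

Deliberately NOT here: the construction of divided differences for multivariate polynomials (the user
supplies `Δ`; for quadrics it is immediate), and the passage from ONE Jacobian minor (one Noether
normalisation) to the full Jacobian ideal (Iyengar–Takahashi 2016 / Wang: sum over normalisations).
-/

-- single-problem summit: the doubled namespace component is forced
set_option linter.dupNamespace false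

noncomputable section

open scoped TensorProduct

universe u

namespace Summit.ResolutionOfSingularities.ResolutionOfSingularities.Theorems.HomologicalConductor.PersistenceBezoutian

open Literature.RingTheory.CohomologyAnnihilator
open Summit.ResolutionOfSingularities.ResolutionOfSingularities.Theorems.HomologicalConductor.PersistenceHypersurfaceJacobian

variable {S : Type u} [CommRing S] {R : Type u} [CommRing R] [Algebra S R]

/-- **Bezoutian lemma.** If `R = S[z₁, …, z_c]` and `Δ ∈ M_c(R ⊗_S R)` satisfies
`Σⱼ Δᵢⱼ (zⱼ ⊗ 1 - 1 ⊗ zⱼ) = 0` for all `i`, then `μ(det Δ) ∈ 𝔑(R/S)`: Cramer's rule gives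
`det Δ · (zⱼ ⊗ 1 - 1 ⊗ zⱼ) = 0`, so `det Δ` centralises the generators and hence all of `R`.
[folklore] -/
theorem lmul_det_mem_noetherDifferent {ι : Type*} [Fintype ι] [DecidableEq ι] (z : ι → R)
    (hz : Algebra.adjoin S (Set.range z) = ⊤) (Δ : Matrix ι ι (R ⊗[S] R))
    (hΔ : ∀ i, ∑ j, Δ i j * (z j ⊗ₜ[S] (1 : R) - (1 : R) ⊗ₜ[S] z j) = 0) :
    Algebra.TensorProduct.lmul' (S := R) S Δ.det ∈ noetherDifferent S R := by
  rw [mem_noetherDifferent_iff]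
  refine ⟨Δ.det, fun b => ?_, rfl⟩
  -- Cramer: `det Δ • v = adj Δ (Δ v) = 0` for `v j = zⱼ ⊗ 1 - 1 ⊗ zⱼ`
  have hv : ∀ j, Δ.det * (z j ⊗ₜ[S] (1 : R) - (1 : R) ⊗ₜ[S] z j) = 0 := by
    have h1 : Δ.mulVec (fun j => z j ⊗ₜ[S] (1 : R) - (1 : R) ⊗ₜ[S] z j) = 0 :=
      funext fun i => hΔ i
    have h2 := congrArg (Δ.adjugate.mulVec) h1
    rw [Matrix.mulVec_mulVec, Matrix.adjugate_mul, Matrix.mulVec_zero, Matrix.smul_mulVec,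
      Matrix.one_mulVec] at h2
    intro j
    have h3 := congrFun h2 j
    simpa only [Pi.smul_apply, smul_eq_mul, Pi.zero_apply] using h3
  -- the centralising property on all of `R = S[z]`
  have hb : b ∈ Algebra.adjoin S (Set.range z) := by rw [hz]; exact Algebra.mem_top
  refine Algebra.adjoin_induction (p := fun b _ =>
    (b ⊗ₜ[S] (1 : R)) * Δ.det = ((1 : R) ⊗ₜ[S] b) * Δ.det) ?_ ?_ ?_ ?_ hb
  · rintro x ⟨j, rfl⟩
    rw [← sub_eq_zero, ← sub_mul, mul_comm]
    exact hv j
  · intro s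
    rw [Algebra.algebraMap_eq_smul_one, TensorProduct.smul_tmul]
  · intro x y _ _ hx hy
    rw [TensorProduct.add_tmul, TensorProduct.tmul_add, add_mul, add_mul, hx, hy]
  · intro x y _ _ hx hy
    have ex : (x * y) ⊗ₜ[S] (1 : R) = (x ⊗ₜ[S] (1 : R)) * (y ⊗ₜ[S] (1 : R)) := by
      rw [Algebra.TensorProduct.tmul_mul_tmul, mul_one]
    have ey : (1 : R) ⊗ₜ[S] (x * y) = ((1 : R) ⊗ₜ[S] y) * ((1 : R) ⊗ₜ[S] x) := by
      rw [Algebra.TensorProduct.tmul_mul_tmul, mul_one, mul_comm y x]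
    rw [ex, ey, mul_assoc, hy, ← mul_assoc, mul_comm (x ⊗ₜ[S] (1 : R)), mul_assoc, hx, ← mul_assoc]

/-- **Bezoutian lemma, determinant-of-images form**: `det (μ(Δᵢⱼ)) ∈ 𝔑(R/S)` — for divided
differences of a presentation this is the Jacobian determinant `det(∂gᵢ/∂zⱼ)`. [folklore] -/
theorem det_map_lmul_mem_noetherDifferent {ι : Type*} [Fintype ι] [DecidableEq ι] (z : ι → R)
    (hz : Algebra.adjoin S (Set.range z) = ⊤) (Δ : Matrix ι ι (R ⊗[S] R))
    (hΔ : ∀ i, ∑ j, Δ i j * (z j ⊗ₜ[S] (1 : R) - (1 : R) ⊗ₜ[S] z j) = 0) :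
    (Δ.map (Algebra.TensorProduct.lmul' (S := R) S)).det ∈ noetherDifferent S R := by
  have h := lmul_det_mem_noetherDifferent z hz Δ hΔ
  rwa [AlgHom.map_det] at h

/-- **Jacobian determinants of complete intersections lie in `caᵈ⁺¹`.** With `R = S[z₁, …, z_c]`
module-finite and projective over a noetherian `S` with `caᵈ⁺¹(S) = S`, and `Δ` a Bezoutian as
above: `det(μ(Δᵢⱼ)) ∈ caᵈ⁺¹(R)` (`𝔑(R/S) ⊆ caᵈ⁺¹(R)`, `noetherDifferent_le_cohomologyAnnihilatorOfDegree`).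
[folklore] -/
theorem det_map_lmul_mem_cohomologyAnnihilatorOfDegree [IsNoetherianRing S] [Module.Finite S R]
    [Module.Projective S R] {d : ℕ} (hvan : cohomologyAnnihilatorOfDegree S (d + 1) = ⊤)
    {ι : Type*} [Fintype ι] [DecidableEq ι] (z : ι → R) (hz : Algebra.adjoin S (Set.range z) = ⊤)
    (Δ : Matrix ι ι (R ⊗[S] R))
    (hΔ : ∀ i, ∑ j, Δ i j * (z j ⊗ₜ[S] (1 : R) - (1 : R) ⊗ₜ[S] z j) = 0) :
    (Δ.map (Algebra.TensorProduct.lmul' (S := R) S)).det ∈ cohomologyAnnihilatorOfDegree R (d + 1) :=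
  noetherDifferent_le_cohomologyAnnihilatorOfDegree hvan (det_map_lmul_mem_noetherDifferent z hz Δ hΔ)

end Summit.ResolutionOfSingularities.ResolutionOfSingularities.Theorems.HomologicalConductor.PersistenceBezoutian

end
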